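import Mathlib
import Summits.ResolutionOfSingularities.ResolutionOfSingularities.Theorems.WeightedInvariantGlobalizeLocalDropCanonize
import Summits.ResolutionOfSingularities.ResolutionOfSingularities.Theorems.WeightedInvariantLocalWeightedDropPlaneNonNCCount

/-!
# `WeightedInvariant.LocalWeightedDrop` IS EQUIVALENT TO THE CONJUNCTION OF ITS THREE OPEN CORES

Crux item stmt-ResolutionOfSingularities-8899 (route `ResolutionOfSingularities/WeightedInvariant`), line
`hasse-ridge-face-selection`, skeleton v15 (registered stub `stub_localWeightedDrop_iff_threeCores`).

After four leads and the proof of the plane-curve input (`planeGermNonNCCount`, strong embedded resolution of plane curve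
germs), the crux `LocalWeightedDrop` (one positional winning strategy of weighted cobordant blow-ups for all singular
hypersurface germs over algebraically closed fields of positive characteristic) is EQUIVALENT to the conjunction of:
* CORE 1 (cubic cones with a non-trivial apex): order `d ≥ 3`, tangent cone `in_d f` translation-invariant along some
  `c ≠ 0`, in `≥ 3` variables, given every singular germ in fewer variables and every singular germ of smaller order in
  the same number of variables — Hironaka/Cossart/Cossart–Jannsen–Saito territory for surfaces, open beyond;
* CORE 2 (wild double points): characteristic `2`, tangent quadric a non-zero square (purely inseparable `x² + h`:
  Hauser's kangaroo germ, Moh's examples), given the same inductive data;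
* CORE 3 (tame double points in `≥ 4` variables): characteristic `≠ 2`, tangent quadric a non-zero square, `≥ 4`
  variables, given the same inductive data.
`⇐` is `localWeightedDrop_of_threeCores` (the tangent-cone cut + the proved plane-curve count); `⇒` is immediate from
`localWeightedDrop_iff_allWon` (the crux makes every singular germ won).
-/

set_option linter.dupNamespace false -- mandated namespace of this single-conjunct summit

namespace Summit.ResolutionOfSingularities.ResolutionOfSingularities.Theorems

open Literature.AlgebraicGeometry.Resolution

/-- THE CRUX `LocalWeightedDrop` ⟺ CORE 1 ∧ CORE 2 ∧ CORE 3 (cubic cones with non-trivial apex; wild double points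
`p = 2`; tame double points in `≥ 4` variables, `p ≠ 2`) — the honest open content of the local weighted resolution game
after the tangent-cone cut and the proof of the strong embedded resolution of plane curve germs. -/
theorem stub_localWeightedDrop_iff_threeCores :
    Summit.ResolutionOfSingularities.ResolutionOfSingularities.Theses.WeightedInvariant.LocalWeightedDrop ↔
    ((∀ (p : ℕ), p.Prime → ∀ (k : Type) [Field k] [CharP k p] [IsAlgClosed k]
    (n : ℕ), (∀ m : ℕ, m < n + 3 → ∀ g : MvPowerSeries (Fin m) k,
      CobordantGame.IsSingular k g → CobordantGame.Won k m g) →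
    ∀ (f : MvPowerSeries (Fin (n + 3)) k), CobordantGame.IsSingular k f →
    (∀ g : MvPowerSeries (Fin (n + 3)) k, CobordantGame.IsSingular k g → g.order < f.order →
      CobordantGame.Won k (n + 3) g) →
    (∀ i j : Fin (n + 3), MvPowerSeries.coeff (Finsupp.single i 1 + Finsupp.single j 1) f = 0) →
    ∀ (d : ℕ), f.order = d →
    (∃ c : Fin (n + 3) → k, c ≠ 0 ∧ ∀ v : Fin (n + 3) → k,
      CobordantChart.initEval (fun _ : Fin (n + 3) => 1) (v + c) d f =
        CobordantChart.initEval (fun _ : Fin (n + 3) => 1) v d f) →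
    CobordantGame.Won k (n + 3) f) ∧
    (∀ (k : Type) [Field k] [CharP k 2] [IsAlgClosed k]
    (n : ℕ), (∀ m : ℕ, m < n + 3 → ∀ g : MvPowerSeries (Fin m) k,
      CobordantGame.IsSingular k g → CobordantGame.Won k m g) →
    ∀ (f : MvPowerSeries (Fin (n + 3)) k), CobordantGame.IsSingular k f →
    (∀ g : MvPowerSeries (Fin (n + 3)) k, CobordantGame.IsSingular k g → g.order < f.order →
      CobordantGame.Won k (n + 3) g) →
    (∃ ℓ : Fin (n + 3) → k, (∃ i, ℓ i ≠ 0) ∧ ∀ i j : Fin (n + 3),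
      MvPowerSeries.coeff (Finsupp.single i 1 + Finsupp.single j 1) f =
        MvPowerSeries.coeff (Finsupp.single i 1 + Finsupp.single j 1)
          ((∑ l, MvPowerSeries.C (ℓ l) * MvPowerSeries.X l) ^ 2)) →
    CobordantGame.Won k (n + 3) f) ∧
    (∀ (p : ℕ), p.Prime → p ≠ 2 →
    ∀ (k : Type) [Field k] [CharP k p] [IsAlgClosed k]
    (n : ℕ), (∀ m : ℕ, m < n + 4 → ∀ g : MvPowerSeries (Fin m) k,
      CobordantGame.IsSingular k g → CobordantGame.Won k m g) →
    ∀ (f : MvPowerSeries (Fin (n + 4)) k), CobordantGame.IsSingular k f →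
    (∀ g : MvPowerSeries (Fin (n + 4)) k, CobordantGame.IsSingular k g → g.order < f.order →
      CobordantGame.Won k (n + 4) g) →
    (∃ ℓ : Fin (n + 4) → k, (∃ i, ℓ i ≠ 0) ∧ ∀ i j : Fin (n + 4),
      MvPowerSeries.coeff (Finsupp.single i 1 + Finsupp.single j 1) f =
        MvPowerSeries.coeff (Finsupp.single i 1 + Finsupp.single j 1)
          ((∑ l, MvPowerSeries.C (ℓ l) * MvPowerSeries.X l) ^ 2)) →
    CobordantGame.Won k (n + 4) f)) := by
  constructor
  · intro h
    have hW := (localWeightedDrop_iff_allWon).mp h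
    refine ⟨?_, ?_, ?_⟩
    · intro p hp k _ _ _ n _ f hf _ _ _ _ _
      exact hW p hp k (n + 3) f hf
    · intro k _ _ _ n _ f hf _ _
      exact hW 2 Nat.prime_two k (n + 3) f hf
    · intro p hp _ k _ _ _ n _ f hf _ _
      exact hW p hp k (n + 4) f hf
  · rintro ⟨h1, h2, h3⟩
    exact localWeightedDrop_of_threeCores h1 h2 h3

end Summit.ResolutionOfSingularities.ResolutionOfSingularities.Theorems
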